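import Summits.BirchSwinnertonDyer.Rank1Residual.X12.O11.RouteUPrimeMember
import Summits.BirchSwinnertonDyer.Rank1Residual.X12.O11.RouteUEulerCriterionNat
import HarnessLib

/-!
# ROUTE U, prime member `D = −151` (curve `49a1^{(−151)}`, `N = 49·151² = 1117249`, beyond the N < 5·10⁵ census window), Heegner field
# `K'' = ℚ(√−83)`: the two Bernoulli-unit certificates, BSD₇ and FULL BSD by the prime-member class theorem

bsd-cm cell (run/shared/lean/pub/bsd-cm/), ROUTE U, seat `bsd-cm-ram` (g6). Instance of
`RouteU.bsdp_seven_of_twist_cm7_prime` at `(q, r) = (151, 83)`: `151 ≡ 83 ≡ 3 (mod 4)`, `(−83/7) = (−83/151) = 1`.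
`W ∈ 𝒞₇` since `(−7/151) = 1`, so the FULL-BSD corollary `forall_bsdp_of_twist_cm7_D151` (`forall_bsdp_of_twist_cm7_prime`) is drawn as well.
Fact-free: no `Fact (Nat.Prime _)` instance is declared (the class theorem's instances are passed as
`⟨by norm_num⟩`; the certificates are stated with Jacobi symbols `J(j | 151)` and bridged to the class theorem's
`legendreSym 151` under the binder by `jacobiSym.legendreSym.to_jacobiSym`). The per-member inputs are the two kernel
certificates (`decide +kernel` with Euler's criterion in `ℕ`-arithmetic, `RouteUEulerCriterionNat.jacobiSym_prime_eq_ite_nat`;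
mod-`49` sums of lengths `1057` and `87731`, the second in 5 blocks of ≤ 20000 terms):
* `norm_generalizedBernoulli_theta1_D151` — `‖B_{1,ω⁴χ_{−151}}‖₇ = 1`;
* `norm_generalizedBernoulli_theta2_D151` — `‖B_{1,ωχ_{−151}χ_{−83}}‖₇ = 1`;
* **`bsdp_seven_of_twist_cm7_D151`** — BSD₇ for every globally minimal model of `49a1^{(−151)}` with `r_an = 1`,
  from the class theorem (named facts: Kriz–Li Thm 1.20 / Rem 3.10, Gross–Zagier, Kolyvagin, GZK, modularity,
  Rubin 1983 Thm C, Burungale–Flach 2024, Buhler–Gross 1985 Ch. II; displayed data: Heegner datum over `ℚ(√−83)`,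
  a Mordell–Weil coordinate over `K`, `L(W^{(−83)},1) ≠ 0`, the twin's minimal model, `7 ∤ c` (Manin constant));
* **`forall_bsdp_of_twist_cm7_D151`** — FULL BSD (Miller's `BSD(E,p)` at every prime) for the same curves.
THEOREMS ONLY; nothing booked. References: [KrizLi2019] Thm. 1.20; [Washington1997] §5.1, Thm 4.2;
[Rubin1983] Thm C; [BuhlerGross1985] Ch. II; [BurungaleFlach2024] Thm 1.1; [Miller2011LMS] Def. 1.1.
-/

noncomputable section

open scoped Classical NumberTheorySymbols
open NumberField WeierstrassCurve DirichletCharacter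
open Literature.NumberTheory.EllipticCurves Literature.NumberTheory.EllipticCurves.Rank1Residual
open Literature.NumberTheory.EllipticCurves.KrizLi2019 Literature.NumberTheory.LFunctions
open Literature.NumberTheory.EllipticCurves.ModularForms

namespace Summit.BirchSwinnertonDyer.Rank1Residual.X12.O11.RouteU

/-- `ord₇ (7·151) = 1`. [folklore] -/
theorem padicValNat_seven_level1_D151 : padicValNat 7 (7 * 151) = 1 := by
  rw [padicValNat.mul (by norm_num) (by norm_num), padicValNat_self, padicValNat.eq_zero_of_not_dvd (by norm_num)]

/-- `ord₇ (7·151·83) = 1`. [folklore] -/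
theorem padicValNat_seven_level2_D151 : padicValNat 7 (7 * 151 * 83) = 1 := by
  rw [show (7 * 151 * 83 : ℕ) = 7 * (151 * 83) by norm_num, padicValNat.mul (by norm_num) (by norm_num),
    padicValNat_self, padicValNat.eq_zero_of_not_dvd (by norm_num)]

set_option maxRecDepth 400000 in
/-- **`‖B_{1,θ₁}‖₇ = 1`** for every character `θ₁` mod `7·151` with values `(j/151)·ω(j)⁴`, `ω`
Teichmüller (certificate `7 ∥ Σ_{j<1057} (j/151) j²⁹`, `decide +kernel`).
[cite: KrizLi2019, Thm. 1.20 (p. 8) and §1.5 (1)] [cite: Washington1997, §5.1 and Thm. 4.2] -/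
theorem norm_generalizedBernoulli_theta1_D151 (ω : DirichletCharacter ℚ_[7] 7)
    (hω : IsTeichmullerCharacter ω) (θ : DirichletCharacter ℚ_[7] (7 * 151))
    (hθ : ∀ j : ZMod (7 * 151), θ j = (J((j.val : ℤ) | 151) : ℚ_[7]) * ω (j.val : ZMod 7) ^ 4) :
    ‖generalizedBernoulli 1 θ‖ = 1 := by
  have hθ1 : θ ≠ 1 := by
    intro h1
    have hv := hθ (((1056 : ℕ)) : ZMod (7 * 151))
    have hval : (((1056 : ℕ) : ZMod (7 * 151))).val = 1056 := by
      rw [ZMod.val_natCast]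
    have h6 : (((1056 : ℕ)) : ZMod 7) = ((6 : ℕ) : ZMod 7) := by decide
    have hu : IsUnit (((1056 : ℕ)) : ZMod (7 * 151)) := by
      rw [ZMod.isUnit_iff_coprime]; norm_num
    rw [h1, hval, MulChar.one_apply hu, h6, apply_neg_one_pow_four, mul_one] at hv
    have hL : J(((1056 : ℕ) : ℤ) | 151) = -1 := by
      rw [jacobiSym_prime_eq_ite_nat 151 (by norm_num) (by norm_num)]; decide
    rw [hL] at hv
    norm_num at hv
  refine norm_generalizedBernoulli_one_eq_one_of_cert_range θ hθ1 padicValNat_seven_level1_D151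
    (fun j => J((j : ℤ) | 151)) 28 (fun j => ?_) (-28179313927948823860322891113179946399612032755019322287369428071810527802485227401823719) ?_ (by norm_num) (by norm_num)
  · have := norm_sub_le_of_values ω hω θ (fun j => J((j : ℤ) | 151)) 4 (by norm_num) hθ j
    simpa using this
  · simp_rw [jacobiSym_prime_eq_ite_nat 151 (by norm_num) (by norm_num)]; decide +kernel

set_option maxRecDepth 400000 in
/-- Block 0 of the `θ₂` certificate for `D = −151`: `Σ_{0 ≤ j < 20000} (j/151)(j/83) j⁸` evaluated (`decide +kernel`). [folklore] -/
theorem theta2_D151_block0 :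
    ∑ j ∈ Finset.Ico (0 : ℕ) 20000,
      (J((j : ℤ) | 151) * J((j : ℤ) | 83)) * (j : ℤ) ^ (7 + 1) = (-786188831147553413511750620251436401) := by
  simp_rw [jacobiSym_prime_eq_ite_nat 151 (by norm_num) (by norm_num), jacobiSym_prime_eq_ite_nat 83 (by norm_num) (by norm_num)]
  decide +kernel

set_option maxRecDepth 400000 in
/-- Block 1 of the `θ₂` certificate for `D = −151`: `Σ_{20000 ≤ j < 40000} (j/151)(j/83) j⁸` evaluated (`decide +kernel`). [folklore] -/
theorem theta2_D151_block1 :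
    ∑ j ∈ Finset.Ico (20000 : ℕ) 40000,
      (J((j : ℤ) | 151) * J((j : ℤ) | 83)) * (j : ℤ) ^ (7 + 1) = (132404560686748074761585091052029453294) := by
  simp_rw [jacobiSym_prime_eq_ite_nat 151 (by norm_num) (by norm_num), jacobiSym_prime_eq_ite_nat 83 (by norm_num) (by norm_num)]
  decide +kernel

set_option maxRecDepth 400000 in
/-- Block 2 of the `θ₂` certificate for `D = −151`: `Σ_{40000 ≤ j < 60000} (j/151)(j/83) j⁸` evaluated (`decide +kernel`). [folklore] -/
theorem theta2_D151_block2 :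
    ∑ j ∈ Finset.Ico (40000 : ℕ) 60000,
      (J((j : ℤ) | 151) * J((j : ℤ) | 83)) * (j : ℤ) ^ (7 + 1) = (-5644854725155963449957746022920904684027) := by
  simp_rw [jacobiSym_prime_eq_ite_nat 151 (by norm_num) (by norm_num), jacobiSym_prime_eq_ite_nat 83 (by norm_num) (by norm_num)]
  decide +kernel

set_option maxRecDepth 400000 in
/-- Block 3 of the `θ₂` certificate for `D = −151`: `Σ_{60000 ≤ j < 80000} (j/151)(j/83) j⁸` evaluated (`decide +kernel`). [folklore] -/
theorem theta2_D151_block3 :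
    ∑ j ∈ Finset.Ico (60000 : ℕ) 80000,
      (J((j : ℤ) | 151) * J((j : ℤ) | 83)) * (j : ℤ) ^ (7 + 1) = (68473634480290406398312291583520189241914) := by
  simp_rw [jacobiSym_prime_eq_ite_nat 151 (by norm_num) (by norm_num), jacobiSym_prime_eq_ite_nat 83 (by norm_num) (by norm_num)]
  decide +kernel

set_option maxRecDepth 400000 in
/-- Block 4 of the `θ₂` certificate for `D = −151`: `Σ_{80000 ≤ j < 87731} (j/151)(j/83) j⁸` evaluated (`decide +kernel`). [folklore] -/
theorem theta2_D151_block4 :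
    ∑ j ∈ Finset.Ico (80000 : ℕ) (7 * 151 * 83),
      (J((j : ℤ) | 151) * J((j : ℤ) | 83)) * (j : ℤ) ^ (7 + 1) = (-47737085904323241998695454615256130220284) := by
  simp_rw [jacobiSym_prime_eq_ite_nat 151 (by norm_num) (by norm_num), jacobiSym_prime_eq_ite_nat 83 (by norm_num) (by norm_num)]
  decide +kernel

/-- The `θ₂` certificate sum for `D = −151` assembled from its blocks, `7 ∥ S₂`. [folklore] -/
theorem theta2_D151_sum :
    ∑ j ∈ Finset.range (7 * 151 * 83),
      (J((j : ℤ) | 151) * J((j : ℤ) | 83)) * (j : ℤ) ^ (7 + 1) = (15223312222666801471007164285774932354496) := by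
  rw [Finset.range_eq_Ico, ← Finset.sum_Ico_consecutive _ (show 0 ≤ 20000 by norm_num) (show 20000 ≤ 7 * 151 * 83 by norm_num),
    ← Finset.sum_Ico_consecutive _ (show 20000 ≤ 40000 by norm_num) (show 40000 ≤ 7 * 151 * 83 by norm_num),
    ← Finset.sum_Ico_consecutive _ (show 40000 ≤ 60000 by norm_num) (show 60000 ≤ 7 * 151 * 83 by norm_num),
    ← Finset.sum_Ico_consecutive _ (show 60000 ≤ 80000 by norm_num) (show 80000 ≤ 7 * 151 * 83 by norm_num),
    theta2_D151_block0, theta2_D151_block1, theta2_D151_block2, theta2_D151_block3, theta2_D151_block4]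
  norm_num

set_option maxRecDepth 400000 in
/-- **`‖B_{1,θ₂}‖₇ = 1`** for every character `θ₂` mod `7·151·83` with values `(j/151)·(j/83)·ω(j)`
(certificate `7 ∥ Σ_{j<87731} (j/151)(j/83) j⁸`, `decide +kernel`).
[cite: KrizLi2019, Thm. 1.20 (p. 8) and §1.5 (1)] [cite: Washington1997, §5.1 and Thm. 4.2] -/
theorem norm_generalizedBernoulli_theta2_D151 (ω : DirichletCharacter ℚ_[7] 7)
    (hω : IsTeichmullerCharacter ω) (θ : DirichletCharacter ℚ_[7] (7 * 151 * 83))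
    (hθ : ∀ j : ZMod (7 * 151 * 83), θ j =
      ((J((j.val : ℤ) | 151) * J((j.val : ℤ) | 83) : ℤ) : ℚ_[7]) * ω (j.val : ZMod 7) ^ 1) :
    ‖generalizedBernoulli 1 θ‖ = 1 := by
  have hθ1 : θ ≠ 1 := by
    intro h1
    have hv := hθ (((87730 : ℕ)) : ZMod (7 * 151 * 83))
    have hval : (((87730 : ℕ) : ZMod (7 * 151 * 83))).val = 87730 := by
      rw [ZMod.val_natCast]
    have hu : IsUnit (((87730 : ℕ)) : ZMod (7 * 151 * 83)) := by
      rw [ZMod.isUnit_iff_coprime]; norm_num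
    rw [h1, hval, MulChar.one_apply hu, pow_one] at hv
    have hL : (J(((87730 : ℕ) : ℤ) | 151) * J(((87730 : ℕ) : ℤ) | 83)) = 1 := by
      rw [jacobiSym_prime_eq_ite_nat 151 (by norm_num) (by norm_num), jacobiSym_prime_eq_ite_nat 83 (by norm_num) (by norm_num)]; decide
    rw [hL, Int.cast_one, one_mul] at hv
    -- `ω(−1) = 1` contradicts `‖ω(6) − 6‖ < 1`
    have h6 : (((87730 : ℕ)) : ZMod 7) = ((6 : ℤ) : ZMod 7) := by decide
    rw [h6] at hv
    have hT := hω 6 (by decide)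
    rw [← hv] at hT
    have : ‖(1 : ℚ_[7]) - ((6 : ℤ) : ℚ_[7])‖ = 1 := by
      rw [show (1 : ℚ_[7]) - ((6 : ℤ) : ℚ_[7]) = -((5 : ℕ) : ℚ_[7]) by norm_num, norm_neg]
      exact Padic.norm_natCast_eq_one_iff.mpr (by decide)
    rw [this] at hT
    exact lt_irrefl _ hT
  refine norm_generalizedBernoulli_one_eq_one_of_cert_range θ hθ1 padicValNat_seven_level2_D151
    (fun j => J((j : ℤ) | 151) * J((j : ℤ) | 83)) 7 (fun j => ?_) (15223312222666801471007164285774932354496)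
    theta2_D151_sum (by norm_num) (by norm_num)
  have := norm_sub_le_of_values ω hω θ (fun j => J((j : ℤ) | 151) * J((j : ℤ) | 83)) 1 le_rfl hθ j
  simpa using this

/-- **ROUTE U, member `D = −151` (`49a1^{(−151)}`, `N = 49·151² = 1117249`): BSD₇ for every globally minimal model of
`49a1^{(−151)}` with `r_an = 1`**, by the prime-member class theorem at `(q, r) = (151, 83)` with the two
certificates above; the descent inputs (no `7`-torsion over `K`, `7 ∤ #Ш(W)`) are discharged inside the
class theorem (Mazur's local step; Buhler–Gross 1985 Ch. II BY NAME, binder `hBG`).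
[cite: KrizLi2019, Thm. 1.20 and Rem. 3.10] [cite: Rubin1983, §0 Thm. C (p. 341)]
[cite: BurungaleFlach2024, Thm 1.1 and Cor. 2] [cite: GrossZagier1986, I.(6.5) and V.(2.1)]
[cite: Miller2011LMS, Thm. 2.5 and (5.1)] [cite: BuhlerGross1985, Ch. II (7.2)(2), (8.3)(1), (9.1) (pp. 16–18)] -/
theorem bsdp_seven_of_twist_cm7_D151
    (hKL : KrizLi2019.thm120_padicLogHeegner_unit_of_bernoulli)
    (hRem : KrizLi2019.rem310_padicLogHeegner_integral)
    (W : WeierstrassCurve ℚ) [W.IsElliptic] [W.IsGloballyMinimal] [NeZero (W.conductorNorm ℤ)]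
    (hW : ∃ C : VariableChange ℚ, C • W = cm7.quadraticTwist ((-(151 : ℕ) : ℤ) : ℚ))
    (K : Type) [Field K] [NumberField K] [NeZero (NumberField.discr K).natAbs]
    (hK : IsImaginaryQuadratic K) (hdK : NumberField.discr K = -(83 : ℕ))
    (D : ModularParametrizationData W (W.conductorNorm ℤ))
    (H : HeegnerDatum (W.conductorNorm ℤ) (NumberField.discr K)) (ι : K →+* ℂ) (ιp : K →+* ℚ_[7])
    (P : (W.baseChange K).toAffine.Point)
    (hGZ : gross_zagier (W.conductorNorm ℤ) W K) (hKo : kolyvagin (W.conductorNorm ℤ) W K)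
    (hGZK : rank_eq_analyticRank_of_analyticRank_le_one) (hmod : hasEntireLFunction_rat)
    (hP : WeierstrassCurve.Affine.Point.map ι.toRatAlgHom P = heegnerPointComplex D H)
    (hr1 : W.analyticRank = 1)
    (hLt : (W.quadraticTwist (NumberField.discr K : ℚ)).entireLFunction 1 ≠ 0)
    (Wd : WeierstrassCurve ℚ) [Wd.IsElliptic] [Wd.IsGloballyMinimal] (Cd : VariableChange ℚ)
    (hWd : Cd • W.quadraticTwist (NumberField.discr K : ℚ) = Wd)
    (hBF : bsdTriple_of_hasCM_of_L_one_ne_zero)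
    (hu : padicValRat 7 (Cd.u : ℚ) = 0)
    (hC : Rubin1983.thmC_seven_quadraticField)
    (hBG : BuhlerGross1985.firstDescent_seven_oddTwist_of_bernoulli)
    [Finite (AddCommGroup.torsion (W.baseChange K).toAffine.Point)]
    (crd : (W.baseChange K).toAffine.Point →+ ℤ) (g : (W.baseChange K).toAffine.Point)
    (hg : crd g = 1) (hker : ∀ x, crd x = 0 → IsOfFinAddOrder x)
    (hc7 : ¬ ((7 : ℤ) ∣ D.c)) :
    BSDp W 7 :=
  bsdp_seven_of_twist_cm7_prime (q := 151) (r := 83) (hq := ⟨by norm_num⟩) (hr := ⟨by norm_num⟩)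
    (by norm_num) (by norm_num) (by norm_num) (by norm_num) (by norm_num) (by norm_num)
    (by rw [legendreSym_eq_ite 7 (by norm_num)]; decide)
    (by rw [jacobiSym.legendreSym.to_jacobiSym, jacobiSym_prime_eq_ite 151 (by norm_num) (by norm_num)]; decide)
    (fun ω hω θ hθ => norm_generalizedBernoulli_theta1_D151 ω hω θ
      (fun j => by rw [hθ j, jacobiSym.legendreSym.to_jacobiSym]))
    (fun ω hω θ hθ => norm_generalizedBernoulli_theta2_D151 ω hω θ
      (fun j => by rw [hθ j, jacobiSym.legendreSym.to_jacobiSym]))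
    hKL hRem W hW K hK hdK D H ι ιp P hGZ hKo hGZK hmod hP hr1 hLt Wd Cd hWd hBF hu hC hBG crd g hg
    hker hc7

/-- **ROUTE U, member `D = −151`: FULL BSD** (Miller's `BSD(E,p)` at EVERY prime `p`) for every globally minimal model of
`49a1^{(−151)}` with `r_an = 1` (`W ∈ 𝒞₇` since `(−7/151) = 1`), by `forall_bsdp_of_twist_cm7_prime` at `(q, r) = (151, 83)`:
BSD₇ from the two certificates above, BSD_p for `p ≠ 7` from the 𝒞₇ assembly `ClassCSeven.forall_bsdp_iff_bsdp_seven`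
(named facts Li–Liu–Tian 2024, Kobayashi 2013, Li–Tian–Yan–Zhu 2025, Burungale–Flach 2024, modularity).
[cite: Miller2011LMS, §1 and Def. 1.1 (arXiv:1010.2431 p. 3)] [cite: KrizLi2019, Thm. 1.20 and Rem. 3.10] -/
theorem forall_bsdp_of_twist_cm7_D151
    (hKL : KrizLi2019.thm120_padicLogHeegner_unit_of_bernoulli)
    (hRem : KrizLi2019.rem310_padicLogHeegner_integral)
    (W : WeierstrassCurve ℚ) [W.IsElliptic] [W.IsGloballyMinimal] [NeZero (W.conductorNorm ℤ)]
    (hW : ∃ C : VariableChange ℚ, C • W = cm7.quadraticTwist ((-(151 : ℕ) : ℤ) : ℚ))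
    (K : Type) [Field K] [NumberField K] [NeZero (NumberField.discr K).natAbs]
    (hK : IsImaginaryQuadratic K) (hdK : NumberField.discr K = -(83 : ℕ))
    (D : ModularParametrizationData W (W.conductorNorm ℤ))
    (H : HeegnerDatum (W.conductorNorm ℤ) (NumberField.discr K)) (ι : K →+* ℂ) (ιp : K →+* ℚ_[7])
    (P : (W.baseChange K).toAffine.Point)
    (hGZ : gross_zagier (W.conductorNorm ℤ) W K) (hKo : kolyvagin (W.conductorNorm ℤ) W K)
    (hGZK : rank_eq_analyticRank_of_analyticRank_le_one) (hmod : hasEntireLFunction_rat)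
    (hP : WeierstrassCurve.Affine.Point.map ι.toRatAlgHom P = heegnerPointComplex D H)
    (hr1 : W.analyticRank = 1)
    (hLt : (W.quadraticTwist (NumberField.discr K : ℚ)).entireLFunction 1 ≠ 0)
    (Wd : WeierstrassCurve ℚ) [Wd.IsElliptic] [Wd.IsGloballyMinimal] (Cd : VariableChange ℚ)
    (hWd : Cd • W.quadraticTwist (NumberField.discr K : ℚ) = Wd)
    (hBF : bsdTriple_of_hasCM_of_L_one_ne_zero)
    (hu : padicValRat 7 (Cd.u : ℚ) = 0)
    (hC : Rubin1983.thmC_seven_quadraticField)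
    (hBG : BuhlerGross1985.firstDescent_seven_oddTwist_of_bernoulli)
    [Finite (AddCommGroup.torsion (W.baseChange K).toAffine.Point)]
    (crd : (W.baseChange K).toAffine.Point →+ ℤ) (g : (W.baseChange K).toAffine.Point)
    (hg : crd g = 1) (hker : ∀ x, crd x = 0 → IsOfFinAddOrder x)
    (hc7 : ¬ ((7 : ℤ) ∣ D.c)) (hLLT : LiLiuTian2024.thm11_bsdp_of_cm_rank_one)
    (hKob : Kobayashi2013.cor14_bsdp_of_cm_rank_one) (hLTYZ : LiTianYanZhu2025.thm11_bsdp_of_cm_rank_one) :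
    ∀ p : ℕ, p.Prime → BSDp W p :=
  forall_bsdp_of_twist_cm7_prime (q := 151) (r := 83) (hq := ⟨by norm_num⟩) (hr := ⟨by norm_num⟩)
    (by norm_num) (by norm_num) (by norm_num) (by norm_num) (by norm_num) (by norm_num)
    (by rw [legendreSym_eq_ite 7 (by norm_num)]; decide)
    (by rw [jacobiSym.legendreSym.to_jacobiSym, jacobiSym_prime_eq_ite 151 (by norm_num) (by norm_num)]; decide)
    (by rw [jacobiSym.legendreSym.to_jacobiSym, jacobiSym_prime_eq_ite 151 (by norm_num) (by norm_num)]; decide)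
    (fun ω hω θ hθ => norm_generalizedBernoulli_theta1_D151 ω hω θ
      (fun j => by rw [hθ j, jacobiSym.legendreSym.to_jacobiSym]))
    (fun ω hω θ hθ => norm_generalizedBernoulli_theta2_D151 ω hω θ
      (fun j => by rw [hθ j, jacobiSym.legendreSym.to_jacobiSym]))
    hKL hRem W hW K hK hdK D H ι ιp P hGZ hKo hGZK hmod hP hr1 hLt Wd Cd hWd hBF hu hC hBG crd g hg
    hker hc7 hLLT hKob hLTYZ

end Summit.BirchSwinnertonDyer.Rank1Residual.X12.O11.RouteU

end
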